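import Literature.Analysis.FluidPDE.TaoEnergyLocalisationPressure
import Literature.Analysis.FluidPDE.RadialCalculus
import HarnessLib

/-!
# Existence of the principal values defining the normalised pressure: discharge of `NS.hasPressurePV_of_contDiff`

The named fact `NS.hasPressurePV_of_contDiff` (`FluidPDE/NormalisedPressureProofs`, input F1 of
Tao's pressure-normalisation lemma and of the commutator representation of
`TaoEnergyLocalisationPressure`; Stein 1970, Ch. III §1): for a `C¹` velocity field `v` on `ℝ³`
with `∫|v|² < ∞`, the principal value `p.v.∫ K(x-y)(v(y)) dy`
(`K(z)(a) = (3⟨z,a⟩² - |a|²|z|²)/(4π|z|⁵)`, `NS.pressureKernel`) exists at **every** point `x`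
(`NS.HasPressurePV v x L`: integrability of the truncated integrands for all small `ε`, and
convergence of `NS.truncatedPressureIntegral v x ε` as `ε → 0⁺`). This file PROVES it
(`hasPressurePV_of_contDiff_holds`).

## Proof

* The truncated integrand is integrable on `{|x-y| > ε}` for every `ε > 0`:
  `|K(x-y)(v(y))| ≤ |v(y)|²/(2π ε³)` there and `|v|² ∈ L¹`
  (`integrableOn_pressureKernel_compl_closedBall`).
* For `0 < ε < ε'` the difference of two truncations is the shell integral
  `∫_{ε<|x-y|≤ε'} K(x-y)(v(y)) dy` (`truncatedPressureIntegral_sub`).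
* **Zero spherical means.** `K(z)(a) = B_z(a,a)` with the bilinear form
  `B_z(a,c) = (3⟨z,a⟩⟨z,c⟩ - ⟨a,c⟩|z|²)/(4π|z|⁵)`; for every shell
  `∫_{ε<|z|≤ε'} K(z)(a) dz = 0`, because the second-moment tensor of the radial weight
  `1_{shell}|z|⁻⁵` is isotropic (`RadialCalculus.integral_radial_mul_inner_mul_inner`:
  `∫ρ⟨z,a⟩² = (|a|²/3)∫ρ|z|²`) (`setIntegral_shell_pressureKernel_eq_zero`).
* **Lipschitz dependence on the velocity.** `|B_z(a,c)| ≤ |a||c|/(π|z|³)`, so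
  `|K(z)(b) - K(z)(a)| = |B_z(b,b-a) + B_z(b-a,a)| ≤ (|a|+|b|)|b-a|/(π|z|³)`.
* Freezing `v(y)` at `v(x)` in the shell integral (whose frozen part vanishes) and using
  `|v| ≤ M₀`, `|v(y)-v(x)| ≤ M₁|y-x|` on `B̄(x,1)` (mean value inequality) gives
  `|∫_{shell}| ≤ (2M₀M₁/π) ∫_{ε<|x-y|≤ε'} |x-y|⁻² dy = 8M₀M₁(ε'-ε)` (polar coordinates,
  `abs_setIntegral_shell_le`), so the truncated integrals are Cauchy along `𝓝[>] 0` and converge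
  (`cauchy_iff_exists_le_nhds`).

This is the classical cancellation argument (Stein 1970, Ch. II §4 and Ch. III §1: truncated
singular integrals of `C¹` functions against mean-zero homogeneous kernels; Gilbarg–Trudinger
(4.9)–(4.10)).

## Main statements

* `abs_pressureKernel_sub_le`, `setIntegral_shell_pressureKernel_eq_zero`,
  `integral_shell_norm_inv_sq`, `abs_setIntegral_shell_le`,
  `abs_truncatedPressureIntegral_sub_le`.
* `hasPressurePV_of_contDiff_holds` — the discharge; `normalisedPressure_eq_of_contDiff`.

## Mathlib / tree search

`Metric.cauchy_iff`, `cauchy_iff_exists_le_nhds`, `Convex.norm_image_sub_le_of_norm_fderiv_le`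
(used); tree: `NS.pressureKernel_eq_fin3`, `NS.measurable_pressureKernel`,
`NS.abs_pressureKernel_le`, `NS.integral_fun_norm_eq`, `NS.integrable_fun_norm_iff`
(`TaoEnergyLocalisationPressure`), `NS.integral_radial_mul_inner_mul_inner` (`RadialCalculus`),
`NS.integrable_sq_of_lintegral_enorm_sq_lt_top` (`TaoEnergyLocalisation`); no singular-integral
theory in Mathlib (`lean search 'HasPressurePV|principal value'`: only the tree's definitions).

## References

* E. M. Stein, *Singular integrals and differentiability properties of functions*, Princeton
  Math. Series 30 (1970) (`Stein1971`): Ch. II §4 (truncated singular integrals), Ch. III §1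
  (the Riesz transforms, (5) p. 51 of the held scan).
* D. Gilbarg, N. S. Trudinger, *Elliptic partial differential equations of second order* (2001),
  (4.9)–(4.10).
* T. Tao, *Localisation and compactness properties of the Navier–Stokes global regularity
  problem*, Anal. PDE 6 (2013) = arXiv:1108.1165 (`Tao2011`): (35), (42).
-/

noncomputable section

open MeasureTheory Set Filter Topology Function Metric InnerProductSpace
open scoped ENNReal NNReal RealInnerProductSpace ContDiff

namespace Literature.Analysis.FluidPDE

/-- Local notation for physical space `ℝ³ = EuclideanSpace ℝ (Fin 3)`. -/
local notation "ℝ³" => EuclideanSpace ℝ (Fin 3)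

/-! ## The pressure kernel as a quadratic form: Lipschitz dependence and zero spherical means -/

section Form

/-- The symmetric bilinear form behind the pressure kernel,
`B_z(a, c) = (3⟨z,a⟩⟨z,c⟩ - ⟨a,c⟩|z|²)/(4π|z|⁵)`, `K(z)(a) = B_z(a, a)`. [folklore] -/
def pressureForm (z a c : ℝ³) : ℝ :=
  (3 * ⟪z, a⟫ * ⟪z, c⟫ - ⟪a, c⟫ * ‖z‖ ^ 2) / (4 * Real.pi * ‖z‖ ^ 5)

/-- `K(z)(a) = B_z(a, a)`. [folklore] -/
theorem pressureKernel_eq_pressureForm (z a : ℝ³) : pressureKernel z a = pressureForm z a a := by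
  rw [pressureKernel_eq_fin3, pressureForm, real_inner_self_eq_norm_sq]
  ring

/-- `|B_z(a, c)| ≤ |a||c|/(π|z|³)`. [folklore] -/
theorem abs_pressureForm_le (z a c : ℝ³) : |pressureForm z a c| ≤ ‖a‖ * ‖c‖ / (Real.pi * ‖z‖ ^ 3) := by
  rcases eq_or_ne z 0 with rfl | hz
  · simp [pressureForm]
  have hz' : 0 < ‖z‖ := norm_pos_iff.2 hz
  rw [pressureForm, abs_div, abs_of_pos (by positivity : (0 : ℝ) < 4 * Real.pi * ‖z‖ ^ 5),
    div_le_div_iff₀ (by positivity) (by positivity)]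
  have i1 : |⟪a, c⟫| ≤ ‖a‖ * ‖c‖ := abs_real_inner_le_norm a c
  have i2 : |⟪z, a⟫| ≤ ‖z‖ * ‖a‖ := abs_real_inner_le_norm z a
  have i3 : |⟪z, c⟫| ≤ ‖z‖ * ‖c‖ := abs_real_inner_le_norm z c
  have h1 : |3 * ⟪z, a⟫ * ⟪z, c⟫ - ⟪a, c⟫ * ‖z‖ ^ 2| ≤ 4 * (‖a‖ * ‖c‖ * ‖z‖ ^ 2) := by
    calc |3 * ⟪z, a⟫ * ⟪z, c⟫ - ⟪a, c⟫ * ‖z‖ ^ 2|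
        ≤ |3 * ⟪z, a⟫ * ⟪z, c⟫| + |⟪a, c⟫ * ‖z‖ ^ 2| := abs_sub _ _
      _ = 3 * (|⟪z, a⟫| * |⟪z, c⟫|) + |⟪a, c⟫| * ‖z‖ ^ 2 := by
          rw [abs_mul, abs_mul, abs_mul, abs_of_nonneg (by positivity : (0 : ℝ) ≤ ‖z‖ ^ 2)]
          norm_num
          ring
      _ ≤ 3 * (‖z‖ * ‖a‖ * (‖z‖ * ‖c‖)) + ‖a‖ * ‖c‖ * ‖z‖ ^ 2 := by gcongr
      _ = 4 * (‖a‖ * ‖c‖ * ‖z‖ ^ 2) := by ring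
  calc |3 * ⟪z, a⟫ * ⟪z, c⟫ - ⟪a, c⟫ * ‖z‖ ^ 2| * (Real.pi * ‖z‖ ^ 3)
      ≤ 4 * (‖a‖ * ‖c‖ * ‖z‖ ^ 2) * (Real.pi * ‖z‖ ^ 3) := by gcongr
    _ = ‖a‖ * ‖c‖ * (4 * Real.pi * ‖z‖ ^ 5) := by ring

/-- **Lipschitz dependence of `K(z)(·)` on the velocity:**
`|K(z)(b) - K(z)(a)| ≤ (|a| + |b|)|b - a|/(π|z|³)`. [folklore] -/
theorem abs_pressureKernel_sub_le (z a b : ℝ³) :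
    |pressureKernel z b - pressureKernel z a| ≤ (‖a‖ + ‖b‖) * ‖b - a‖ / (Real.pi * ‖z‖ ^ 3) := by
  have key : pressureKernel z b - pressureKernel z a = pressureForm z b (b - a) + pressureForm z (b - a) a := by
    rw [pressureKernel_eq_pressureForm, pressureKernel_eq_pressureForm]
    simp only [pressureForm, inner_sub_left, inner_sub_right]
    rcases eq_or_ne z 0 with rfl | hz
    · simp
    · have : (4 * Real.pi * ‖z‖ ^ 5) ≠ 0 := by positivity
      field_simp
      rw [real_inner_comm a b]
      ring
  rw [key]
  calc |pressureForm z b (b - a) + pressureForm z (b - a) a|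
      ≤ |pressureForm z b (b - a)| + |pressureForm z (b - a) a| := abs_add_le _ _
    _ ≤ ‖b‖ * ‖b - a‖ / (Real.pi * ‖z‖ ^ 3) + ‖b - a‖ * ‖a‖ / (Real.pi * ‖z‖ ^ 3) :=
        add_le_add (abs_pressureForm_le _ _ _) (abs_pressureForm_le _ _ _)
    _ = (‖a‖ + ‖b‖) * ‖b - a‖ / (Real.pi * ‖z‖ ^ 3) := by ring

variable {ε ε' : ℝ}

/-- **Zero spherical means:** `∫_{ε < |z| ≤ ε'} K(z)(a) dz = 0` (the second-moment tensor of the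
radial weight `1_{shell}|z|⁻⁵` is isotropic: `∫ 3⟨z,a⟩²|z|⁻⁵ = |a|² ∫|z|⁻³` over the shell).
[folklore] -/
theorem setIntegral_shell_pressureKernel_eq_zero (hε : 0 < ε) (a : ℝ³) :
    ∫ z in closedBall (0 : ℝ³) ε' \ closedBall 0 ε, pressureKernel z a = 0 := by
  set S : Set ℝ³ := closedBall (0 : ℝ³) ε' \ closedBall 0 ε with hS
  have hSm : MeasurableSet S := measurableSet_closedBall.diff measurableSet_closedBall
  have hSb : S ⊆ closedBall (0 : ℝ³) ε' := sdiff_subset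
  have hSz : ∀ z ∈ S, ε < ‖z‖ := fun z hz => by
    have := hz.2
    rw [mem_closedBall_zero_iff, not_le] at this
    exact this
  -- the radial weight
  set ρ : ℝ³ → ℝ := S.indicator fun z => 3 / (4 * Real.pi * ‖z‖ ^ 5) with hρ
  have hρrad : ∀ x y : ℝ³, ‖x‖ = ‖y‖ → ρ x = ρ y := by
    intro x y hxy
    simp only [hρ, indicator, hS, Set.mem_sdiff, mem_closedBall, dist_zero_right, hxy]
  have hcont : ContinuousOn (fun z : ℝ³ => 3 / (4 * Real.pi * ‖z‖ ^ 5)) S := by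
    refine (continuousOn_const.div (by fun_prop) fun z hz => ?_)
    have : 0 < ‖z‖ := hε.trans (hSz z hz)
    positivity
  have hρm : AEStronglyMeasurable ρ volume := by
    rw [hρ, aestronglyMeasurable_indicator_iff hSm]
    exact hcont.aestronglyMeasurable hSm
  -- bounded functions on the bounded set `S` are integrable
  have hSfin : volume S < ⊤ := (measure_mono hSb).trans_lt (isCompact_closedBall _ _).measure_lt_top
  have hint : ∀ {g : ℝ³ → ℝ}, ContinuousOn g S → (∀ z ∈ S, |g z| ≤ (3 / (4 * Real.pi * ε ^ 5)) * (ε' ^ 2 * (‖a‖ ^ 2 + 1))) →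
      IntegrableOn g S := by
    intro g hg hb
    refine ⟨hg.aestronglyMeasurable hSm, HasFiniteIntegral.restrict_of_bounded
      ((3 / (4 * Real.pi * ε ^ 5)) * (ε' ^ 2 * (‖a‖ ^ 2 + 1))) hSfin ?_⟩
    exact (ae_restrict_iff' hSm).2 (Eventually.of_forall fun z hz => Real.norm_eq_abs _ ▸ hb z hz)
  -- size of the weight on the shell
  have hwt : ∀ z ∈ S, |3 / (4 * Real.pi * ‖z‖ ^ 5)| ≤ 3 / (4 * Real.pi * ε ^ 5) := by
    intro z hz
    have hzε := hSz z hz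
    have hz0 : 0 < ‖z‖ := hε.trans hzε
    rw [abs_of_pos (by positivity)]
    gcongr
  have hzn : ∀ z ∈ S, ‖z‖ ≤ ε' := fun z hz => mem_closedBall_zero_iff.1 (hSb hz)
  -- the two integrands
  have hi1 : IntegrableOn (fun z : ℝ³ => 3 / (4 * Real.pi * ‖z‖ ^ 5) * (⟪z, a⟫ * ⟪z, a⟫)) S := by
    refine hint (hcont.mul (by fun_prop)) fun z hz => ?_
    rw [abs_mul]
    refine mul_le_mul (hwt z hz) ?_ (abs_nonneg _) (by positivity)
    have h1 : |⟪z, a⟫| ≤ ‖z‖ * ‖a‖ := abs_real_inner_le_norm z a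
    have h2 : ‖z‖ ≤ ε' := hzn z hz
    rw [abs_mul]
    have hε'0 : 0 ≤ ε' := (norm_nonneg z).trans h2
    calc |⟪z, a⟫| * |⟪z, a⟫| ≤ (‖z‖ * ‖a‖) * (‖z‖ * ‖a‖) :=
          mul_le_mul h1 h1 (abs_nonneg _) (by positivity)
      _ = ‖z‖ ^ 2 * ‖a‖ ^ 2 := by ring
      _ ≤ ε' ^ 2 * (‖a‖ ^ 2 + 1) := by
          have : ‖z‖ ^ 2 ≤ ε' ^ 2 := pow_le_pow_left₀ (norm_nonneg _) h2 2
          nlinarith [sq_nonneg ‖a‖, sq_nonneg ε']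
  have hi2 : IntegrableOn (fun z : ℝ³ => 3 / (4 * Real.pi * ‖z‖ ^ 5) * ‖z‖ ^ 2) S := by
    refine hint (hcont.mul (by fun_prop)) fun z hz => ?_
    rw [abs_mul, abs_of_nonneg (by positivity : (0 : ℝ) ≤ ‖z‖ ^ 2)]
    refine mul_le_mul (hwt z hz) ?_ (by positivity) (by positivity)
    have h2 : ‖z‖ ≤ ε' := hzn z hz
    have : ‖z‖ ^ 2 ≤ ε' ^ 2 := pow_le_pow_left₀ (norm_nonneg _) h2 2
    nlinarith [sq_nonneg ‖a‖, sq_nonneg ε']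
  have hρint : Integrable fun z => ρ z * ‖z‖ ^ 2 := by
    have : (fun z => ρ z * ‖z‖ ^ 2) = S.indicator fun z => 3 / (4 * Real.pi * ‖z‖ ^ 5) * ‖z‖ ^ 2 := by
      funext z
      simp only [hρ, indicator]
      split_ifs <;> ring
    rw [this, integrable_indicator_iff hSm]
    exact hi2
  have hiso := integral_radial_mul_inner_mul_inner hρrad hρm hρint a a
  rw [finrank_euclideanSpace_fin, real_inner_self_eq_norm_sq] at hiso
  push_cast at hiso
  -- `∫_S K = ∫ ρ⟨z,a⟩² - (|a|²/3) ∫ ρ|z|²`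
  have e1 : ∫ z, ρ z * (⟪z, a⟫ * ⟪z, a⟫) = ∫ z in S, 3 / (4 * Real.pi * ‖z‖ ^ 5) * (⟪z, a⟫ * ⟪z, a⟫) := by
    rw [← integral_indicator hSm]
    refine integral_congr_ae (Eventually.of_forall fun z => ?_)
    simp only [hρ, indicator]
    split_ifs <;> ring
  have e2 : ∫ z, ρ z * ‖z‖ ^ 2 = ∫ z in S, 3 / (4 * Real.pi * ‖z‖ ^ 5) * ‖z‖ ^ 2 := by
    rw [← integral_indicator hSm]
    refine integral_congr_ae (Eventually.of_forall fun z => ?_)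
    simp only [hρ, indicator]
    split_ifs <;> ring
  have hK : ∀ z, pressureKernel z a =
      3 / (4 * Real.pi * ‖z‖ ^ 5) * (⟪z, a⟫ * ⟪z, a⟫) - ‖a‖ ^ 2 / 3 * (3 / (4 * Real.pi * ‖z‖ ^ 5) * ‖z‖ ^ 2) := by
    intro z
    rw [pressureKernel_eq_fin3]
    ring
  simp_rw [hK]
  rw [integral_sub hi1 (hi2.const_mul _), integral_const_mul, ← e1, ← e2, hiso]
  ring

end Form

/-! ## Shell integrals of `|z|⁻²` -/

section Shell

variable {ε ε' : ℝ}

/-- **`∫_{ε<|z|≤ε'} |z|⁻² dz = 4π(ε' - ε)`** on `ℝ³` (polar coordinates), recorded as the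
integrability of the majorant `1_{ε<|z|≤ε'}|z|⁻²` together with the value of its integral.
[folklore] -/
theorem integral_shell_norm_inv_sq (hε : 0 < ε) (hεε' : ε ≤ ε') :
    Integrable (fun z : ℝ³ => (Ioc ε ε').indicator (fun ρ : ℝ => (ρ ^ 2)⁻¹) ‖z‖) ∧
      ∫ z : ℝ³, (Ioc ε ε').indicator (fun ρ : ℝ => (ρ ^ 2)⁻¹) ‖z‖ = 4 * Real.pi * (ε' - ε) := by
  set f : ℝ → ℝ := (Ioc ε ε').indicator fun ρ : ℝ => (ρ ^ 2)⁻¹ with hf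
  have hpt : ∀ ρ ∈ Ioi (0 : ℝ), ρ ^ 2 * f ρ = (Ioc ε ε').indicator (fun _ => (1 : ℝ)) ρ := by
    intro ρ hρ
    simp only [hf, indicator]
    split_ifs with h
    · have : ρ ≠ 0 := (lt_trans hε h.1).ne'
      field_simp
    · ring
  have hvol : volume (Ioc ε ε') ≠ ⊤ := by rw [Real.volume_Ioc]; exact ENNReal.ofReal_ne_top
  have hind : Integrable ((Ioc ε ε').indicator fun _ : ℝ => (1 : ℝ)) :=
    (integrable_indicator_iff measurableSet_Ioc).2 (integrableOn_const (hs := hvol))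
  have hI : IntegrableOn (fun ρ : ℝ => ρ ^ 2 * f ρ) (Ioi 0) :=
    hind.integrableOn.congr_fun (fun ρ hρ => (hpt ρ hρ).symm) measurableSet_Ioi
  refine ⟨(integrable_fun_norm_iff f).2 hI, ?_⟩
  rw [integral_fun_norm_eq f, setIntegral_congr_fun measurableSet_Ioi hpt,
    setIntegral_indicator measurableSet_Ioc,
    show Ioi (0 : ℝ) ∩ Ioc ε ε' = Ioc ε ε' from
      inter_eq_right.2 fun ρ hρ => lt_trans hε hρ.1,
    setIntegral_const, Real.volume_real_Ioc_of_le hεε', smul_eq_mul, mul_one]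

end Shell

/-! ## The principal values -/

section PV

variable {v : ℝ³ → ℝ³} {x : ℝ³} {ε ε' : ℝ}

/-- **Integrability of the truncated integrand:** for `v` continuous with `∫|v|² < ∞` and every
`ε > 0`, `y ↦ K(x-y)(v(y))` is integrable on `{|x-y| > ε}` (`|K(x-y)(v(y))| ≤ |v(y)|²/(2πε³)`).
[folklore] -/
theorem integrableOn_pressureKernel_compl_closedBall (hv : Continuous v)
    (hv2 : Integrable fun y => ‖v y‖ ^ 2) (x : ℝ³) (hε : 0 < ε) :
    IntegrableOn (fun y => pressureKernel (x - y) (v y)) (closedBall x ε)ᶜ := by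
  have hmeas : AEStronglyMeasurable (fun y => pressureKernel (x - y) (v y)) volume := by
    have h3 : Measurable fun y : ℝ³ => (x - y, v y) :=
      (measurable_const.sub measurable_id).prodMk hv.measurable
    exact (measurable_pressureKernel.comp h3).aestronglyMeasurable
  refine Integrable.mono' ((hv2.div_const (2 * Real.pi * ε ^ 3)).integrableOn)
    hmeas.restrict ?_
  rw [ae_restrict_iff' measurableSet_closedBall.compl]
  refine Eventually.of_forall fun y hy => ?_
  rw [mem_compl_iff, mem_closedBall, not_le, dist_eq_norm, ← norm_neg, neg_sub] at hy
  rw [Real.norm_eq_abs]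
  calc |pressureKernel (x - y) (v y)| ≤ ‖v y‖ ^ 2 / (2 * Real.pi * ‖x - y‖ ^ 3) :=
        abs_pressureKernel_le _ _
    _ ≤ ‖v y‖ ^ 2 / (2 * Real.pi * ε ^ 3) := by
        gcongr

/-- **The difference of two truncations is the shell integral:** for `0 < ε < ε'`,
`∫_{|x-y|>ε} K(x-y)(v(y)) dy - ∫_{|x-y|>ε'} K(x-y)(v(y)) dy = ∫_{ε<|x-y|≤ε'} K(x-y)(v(y)) dy`.
[folklore] -/
theorem truncatedPressureIntegral_sub (hv : Continuous v) (hv2 : Integrable fun y => ‖v y‖ ^ 2)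
    (x : ℝ³) (hε : 0 < ε) (hεε' : ε < ε') :
    truncatedPressureIntegral v x ε - truncatedPressureIntegral v x ε' =
      ∫ y in closedBall x ε' \ closedBall x ε, pressureKernel (x - y) (v y) := by
  have hdisj : Disjoint (closedBall x ε')ᶜ (closedBall x ε' \ closedBall x ε) :=
    disjoint_left.2 fun y hy hy' => hy hy'.1
  have hunion : (closedBall x ε)ᶜ = (closedBall x ε')ᶜ ∪ (closedBall x ε' \ closedBall x ε) := by
    ext y
    simp only [mem_compl_iff, mem_union, Set.mem_sdiff]
    constructor
    · intro h
      by_cases h' : y ∈ closedBall x ε'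
      · exact Or.inr ⟨h', h⟩
      · exact Or.inl h'
    · rintro (h | ⟨-, h⟩)
      · exact fun h'' => h (closedBall_subset_closedBall hεε'.le h'')
      · exact h
  have hint := integrableOn_pressureKernel_compl_closedBall hv hv2 x hε
  rw [truncatedPressureIntegral, truncatedPressureIntegral, hunion,
    setIntegral_union hdisj (measurableSet_closedBall.diff measurableSet_closedBall)
      (hint.mono_set (by rw [hunion]; exact subset_union_left))
      (hint.mono_set (by rw [hunion]; exact subset_union_right))]
  ring

/-- The frozen-coefficient shell integral vanishes:
`∫_{ε<|x-y|≤ε'} K(x-y)(a) dy = 0` (translate to the origin and use the zero spherical means).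
[folklore] -/
theorem setIntegral_shell_pressureKernel_const_eq_zero (hε : 0 < ε) (x a : ℝ³) :
    ∫ y in closedBall x ε' \ closedBall x ε, pressureKernel (x - y) a = 0 := by
  set S : Set ℝ³ := closedBall x ε' \ closedBall x ε with hS
  set S₀ : Set ℝ³ := closedBall (0 : ℝ³) ε' \ closedBall 0 ε with hS₀
  have hSm : MeasurableSet S := measurableSet_closedBall.diff measurableSet_closedBall
  have hS₀m : MeasurableSet S₀ := measurableSet_closedBall.diff measurableSet_closedBall
  rw [← integral_indicator hSm]
  set F : ℝ³ → ℝ := S₀.indicator fun z => pressureKernel z a with hF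
  have hpt : ∀ y, S.indicator (fun y => pressureKernel (x - y) a) y = F (x - y) := by
    intro y
    have hiff : y ∈ S ↔ x - y ∈ S₀ := by
      simp only [hS, hS₀, Set.mem_sdiff, mem_closedBall, dist_eq_norm, ← norm_neg (y - x), neg_sub,
        sub_zero]
    by_cases hy : y ∈ S
    · rw [indicator_of_mem hy, hF, indicator_of_mem (hiff.1 hy)]
    · rw [indicator_of_notMem hy, hF, indicator_of_notMem (fun h => hy (hiff.2 h))]
  calc ∫ y, S.indicator (fun y => pressureKernel (x - y) a) y = ∫ y, F (x - y) :=
        integral_congr_ae (Eventually.of_forall hpt)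
    _ = ∫ z, F z := integral_sub_left_eq_self F volume x
    _ = ∫ z in S₀, pressureKernel z a := integral_indicator hS₀m
    _ = 0 := setIntegral_shell_pressureKernel_eq_zero hε a

/-- **The shell integral is `O(ε')`:** if `|v| ≤ M₀` and `|v(y) - v(x)| ≤ M₁|y - x|` on the ball
`B̄(x, 1)`, then for `0 < ε ≤ ε' ≤ 1`,
`|∫_{ε<|x-y|≤ε'} K(x-y)(v(y)) dy| ≤ 8 M₀ M₁ (ε' - ε)`
(freeze `v(y)` at `v(x)`, whose shell integral vanishes, and bound the remainder by
`2M₀M₁|x-y|⁻²/π` on the shell, whose integral is `4π(ε'-ε)`). [folklore] -/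
theorem abs_setIntegral_shell_le (hv : Continuous v) {M₀ M₁ : ℝ}
    (hM₀ : ∀ y ∈ closedBall x 1, ‖v y‖ ≤ M₀) (hM₁ : ∀ y ∈ closedBall x 1, ‖v y - v x‖ ≤ M₁ * ‖y - x‖)
    (hM₁0 : 0 ≤ M₁) (hε : 0 < ε) (hεε' : ε ≤ ε') (hε'1 : ε' ≤ 1) :
    |∫ y in closedBall x ε' \ closedBall x ε, pressureKernel (x - y) (v y)| ≤ 8 * M₀ * M₁ * (ε' - ε) := by
  set S : Set ℝ³ := closedBall x ε' \ closedBall x ε with hS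
  have hSm : MeasurableSet S := measurableSet_closedBall.diff measurableSet_closedBall
  have hM₀0 : 0 ≤ M₀ := (norm_nonneg _).trans (hM₀ x (mem_closedBall_self zero_le_one))
  have hS1 : S ⊆ closedBall x 1 := fun y hy => closedBall_subset_closedBall hε'1 hy.1
  have hSz : ∀ y ∈ S, ε < ‖x - y‖ ∧ ‖x - y‖ ≤ ε' := fun y hy => by
    have h1 := hy.1; have h2 := hy.2
    rw [mem_closedBall, dist_eq_norm, ← norm_neg, neg_sub] at h1 h2
    exact ⟨not_le.1 h2, h1⟩
  -- the majorant on the shell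
  set m : ℝ³ → ℝ := fun y => 2 * M₀ * M₁ / Real.pi * (Ioc ε ε').indicator (fun ρ : ℝ => (ρ ^ 2)⁻¹) ‖x - y‖
    with hm
  obtain ⟨hshell_int, hshell_val⟩ := integral_shell_norm_inv_sq (ε := ε) (ε' := ε') hε hεε'
  have hmi : Integrable m := ((hshell_int.comp_sub_left x).const_mul (2 * M₀ * M₁ / Real.pi))
  have hmval : ∫ y, m y = 8 * M₀ * M₁ * (ε' - ε) := by
    rw [hm, integral_const_mul,
      integral_sub_left_eq_self (fun z : ℝ³ => (Ioc ε ε').indicator (fun ρ : ℝ => (ρ ^ 2)⁻¹) ‖z‖) volume x,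
      hshell_val]
    field_simp
    ring
  -- the difference integrand and its bound
  have hdiff : ∀ y ∈ S, |pressureKernel (x - y) (v y) - pressureKernel (x - y) (v x)| ≤ m y := by
    intro y hy
    obtain ⟨h1, h2⟩ := hSz y hy
    have hy1 : y ∈ closedBall x 1 := hS1 hy
    have hxy0 : 0 < ‖x - y‖ := hε.trans h1
    calc |pressureKernel (x - y) (v y) - pressureKernel (x - y) (v x)|
        ≤ (‖v x‖ + ‖v y‖) * ‖v y - v x‖ / (Real.pi * ‖x - y‖ ^ 3) := abs_pressureKernel_sub_le _ _ _
      _ ≤ (M₀ + M₀) * (M₁ * ‖x - y‖) / (Real.pi * ‖x - y‖ ^ 3) := by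
          gcongr
          · exact hM₀ x (mem_closedBall_self zero_le_one)
          · exact hM₀ y hy1
          · have h := hM₁ y hy1
            rwa [← norm_neg (y - x), neg_sub] at h
      _ = m y := by
          rw [hm]
          simp only
          rw [indicator_of_mem (show ‖x - y‖ ∈ Ioc ε ε' from ⟨h1, h2⟩)]
          field_simp
          ring
  -- integrability of the two pieces on `S`
  have hSfin : volume S < ⊤ :=
    (measure_mono (show S ⊆ closedBall x ε' from fun y hy => hy.1)).trans_lt
      (isCompact_closedBall _ _).measure_lt_top
  have hmeasK : ∀ (g : ℝ³ → ℝ³), Continuous g →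
      AEStronglyMeasurable (fun y => pressureKernel (x - y) (g y)) (volume.restrict S) := by
    intro g hg
    have h3 : Measurable fun y : ℝ³ => (x - y, g y) :=
      (measurable_const.sub measurable_id).prodMk hg.measurable
    exact (measurable_pressureKernel.comp h3).aestronglyMeasurable
  have hbd : ∀ (g : ℝ³ → ℝ³), Continuous g → (∀ y ∈ S, ‖g y‖ ≤ M₀) →
      IntegrableOn (fun y => pressureKernel (x - y) (g y)) S := by
    intro g hgc hg
    refine ⟨hmeasK g hgc, HasFiniteIntegral.restrict_of_bounded (M₀ ^ 2 / (2 * Real.pi * ε ^ 3)) hSfin ?_⟩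
    rw [ae_restrict_iff' hSm]
    refine Eventually.of_forall fun y hy => ?_
    rw [Real.norm_eq_abs]
    have h1 := (hSz y hy).1
    calc |pressureKernel (x - y) (g y)| ≤ ‖g y‖ ^ 2 / (2 * Real.pi * ‖x - y‖ ^ 3) :=
          abs_pressureKernel_le _ _
      _ ≤ M₀ ^ 2 / (2 * Real.pi * ε ^ 3) := by
          gcongr
          exact hg y hy
  have hi1 : IntegrableOn (fun y => pressureKernel (x - y) (v y)) S :=
    hbd v hv fun y hy => hM₀ y (hS1 hy)
  have hi2 : IntegrableOn (fun y => pressureKernel (x - y) (v x)) S :=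
    hbd (fun _ => v x) continuous_const fun y _ => hM₀ x (mem_closedBall_self zero_le_one)
  -- split off the frozen coefficient
  have hsplit : ∫ y in S, pressureKernel (x - y) (v y) =
      (∫ y in S, (pressureKernel (x - y) (v y) - pressureKernel (x - y) (v x))) +
        ∫ y in S, pressureKernel (x - y) (v x) := by
    rw [integral_sub hi1 hi2]
    ring
  rw [hsplit, setIntegral_shell_pressureKernel_const_eq_zero hε x (v x), add_zero]
  have hm0 : ∀ y, 0 ≤ m y := fun y => by
    rw [hm]
    refine mul_nonneg (by positivity) ?_
    simp only [indicator]
    split_ifs <;> positivity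
  calc |∫ y in S, (pressureKernel (x - y) (v y) - pressureKernel (x - y) (v x))|
      ≤ ∫ y in S, |pressureKernel (x - y) (v y) - pressureKernel (x - y) (v x)| :=
        abs_integral_le_integral_abs
    _ ≤ ∫ y in S, m y := setIntegral_mono_on (hi1.sub hi2).abs hmi.integrableOn hSm hdiff
    _ ≤ ∫ y, m y := setIntegral_le_integral hmi (Eventually.of_forall hm0)
    _ = 8 * M₀ * M₁ * (ε' - ε) := hmval

/-- Local bounds for a `C¹` field on the unit ball around `x`: `|v| ≤ M₀` and the mean value
inequality `|v(y) - v(x)| ≤ M₁ |y - x|`, `M₁ = sup_{B̄(x,1)} ‖Dv‖`. [folklore] -/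
theorem exists_local_bounds (hv : ContDiff ℝ 1 v) (x : ℝ³) :
    ∃ M₀ M₁ : ℝ, 0 ≤ M₁ ∧ (∀ y ∈ closedBall x 1, ‖v y‖ ≤ M₀) ∧
      ∀ y ∈ closedBall x 1, ‖v y - v x‖ ≤ M₁ * ‖y - x‖ := by
  obtain ⟨M₀, hM₀⟩ := (isCompact_closedBall x 1).exists_bound_of_continuousOn hv.continuous.continuousOn
  obtain ⟨M₁, hM₁⟩ := (isCompact_closedBall x 1).exists_bound_of_continuousOn
    (hv.continuous_fderiv one_ne_zero).continuousOn
  refine ⟨M₀, max M₁ 0, le_max_right _ _, hM₀, fun y hy => ?_⟩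
  have hd : ∀ z ∈ closedBall x 1, DifferentiableAt ℝ v z := fun z _ =>
    hv.differentiable one_ne_zero z
  exact (convex_closedBall x 1).norm_image_sub_le_of_norm_fderiv_le hd
    (fun z hz => (hM₁ z hz).trans (le_max_left _ _)) (mem_closedBall_self zero_le_one) hy

/-- **The truncated singular integrals are Cauchy as `ε → 0⁺`:** for `0 < ε ≤ ε' ≤ 1`,
`|T_ε(x) - T_{ε'}(x)| ≤ 8M₀M₁(ε' - ε)`. [folklore] -/
theorem abs_truncatedPressureIntegral_sub_le (hv : ContDiff ℝ 1 v) (hv2 : Integrable fun y => ‖v y‖ ^ 2)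
    {M₀ M₁ : ℝ} (hM₀ : ∀ y ∈ closedBall x 1, ‖v y‖ ≤ M₀)
    (hM₁ : ∀ y ∈ closedBall x 1, ‖v y - v x‖ ≤ M₁ * ‖y - x‖) (hM₁0 : 0 ≤ M₁)
    (hε : 0 < ε) (hεε' : ε ≤ ε') (hε'1 : ε' ≤ 1) :
    |truncatedPressureIntegral v x ε - truncatedPressureIntegral v x ε'| ≤ 8 * M₀ * M₁ * (ε' - ε) := by
  rcases eq_or_lt_of_le hεε' with rfl | hlt
  · rw [sub_self, abs_zero, sub_self, mul_zero]
  rw [truncatedPressureIntegral_sub hv.continuous hv2 x hε hlt]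
  exact abs_setIntegral_shell_le hv.continuous hM₀ hM₁ hM₁0 hε hεε' hε'1

/-- **Discharge of `NS.hasPressurePV_of_contDiff`** (Stein 1970, Ch. III §1; Gilbarg–Trudinger
(4.9)): for a `C¹` velocity field of finite energy on `ℝ³` the principal value
`p.v.∫ K(x - y)(v(y)) dy` exists at every point. Proof: the truncated integrands are integrable
for every `ε > 0` (`|K(z)(a)| ≤ |a|²/(2π|z|³)`, `v ∈ L²`), and the truncated integrals are
Cauchy as `ε → 0⁺`: their differences are shell integrals, the frozen-coefficient shell
integral vanishes by the zero spherical means of `K(·)(a)` (isotropy of the second moments of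
radial weights, `RadialCalculus`), and the remainder is `≤ 8 M₀M₁ (ε' - ε)` by the Lipschitz
dependence of `K(z)(·)` on the velocity and the local Lipschitz bound for `v`.
[cite: Stein1971, Ch. III §1] -/
theorem hasPressurePV_of_contDiff_holds : hasPressurePV_of_contDiff := by
  intro v hv hE x
  have hv2 : Integrable fun y => ‖v y‖ ^ 2 := integrable_sq_of_lintegral_enorm_sq_lt_top hv.continuous hE
  obtain ⟨M₀, M₁, hM₁0, hM₀, hM₁⟩ := exists_local_bounds hv x
  set T := truncatedPressureIntegral v x with hT
  -- Cauchy criterion along `𝓝[>] 0`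
  have hC : Cauchy (map T (𝓝[>] (0 : ℝ))) := by
    rw [Metric.cauchy_iff]
    refine ⟨inferInstance, fun δ hδ => ?_⟩
    -- choose `η ≤ 1` with `8 M₀ M₁ η < δ`
    obtain ⟨η, hη0, hη1, hηδ⟩ : ∃ η : ℝ, 0 < η ∧ η ≤ 1 ∧ 8 * M₀ * M₁ * η < δ := by
      have hM₀0 : 0 ≤ M₀ := (norm_nonneg _).trans (hM₀ x (mem_closedBall_self zero_le_one))
      refine ⟨min 1 (δ / (8 * M₀ * M₁ + 1)), by positivity, min_le_left _ _, ?_⟩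
      have h1 : 8 * M₀ * M₁ * min 1 (δ / (8 * M₀ * M₁ + 1)) ≤ 8 * M₀ * M₁ * (δ / (8 * M₀ * M₁ + 1)) :=
        mul_le_mul_of_nonneg_left (min_le_right _ _) (by positivity)
      have h2 : 8 * M₀ * M₁ * (δ / (8 * M₀ * M₁ + 1)) < δ := by
        rw [mul_div_assoc', div_lt_iff₀ (by positivity)]
        nlinarith
      exact h1.trans_lt h2
    refine ⟨T '' Ioo 0 η, image_mem_map (Ioo_mem_nhdsGT hη0), ?_⟩
    rintro _ ⟨a, ha, rfl⟩ _ ⟨b, hb, rfl⟩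
    rw [Real.dist_eq]
    rcases le_total a b with hab | hab
    · calc |T a - T b| ≤ 8 * M₀ * M₁ * (b - a) :=
            abs_truncatedPressureIntegral_sub_le hv hv2 hM₀ hM₁ hM₁0 ha.1 hab (hb.2.le.trans hη1)
        _ ≤ 8 * M₀ * M₁ * η := by
            have hM₀0 : 0 ≤ M₀ := (norm_nonneg _).trans (hM₀ x (mem_closedBall_self zero_le_one))
            exact mul_le_mul_of_nonneg_left (by linarith [ha.1, hb.2]) (by positivity)
        _ < δ := hηδ
    · rw [abs_sub_comm]
      calc |T b - T a| ≤ 8 * M₀ * M₁ * (a - b) :=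
            abs_truncatedPressureIntegral_sub_le hv hv2 hM₀ hM₁ hM₁0 hb.1 hab (ha.2.le.trans hη1)
        _ ≤ 8 * M₀ * M₁ * η := by
            have hM₀0 : 0 ≤ M₀ := (norm_nonneg _).trans (hM₀ x (mem_closedBall_self zero_le_one))
            exact mul_le_mul_of_nonneg_left (by linarith [hb.1, ha.2]) (by positivity)
        _ < δ := hηδ
  obtain ⟨L, hL⟩ := cauchy_iff_exists_le_nhds.1 hC
  refine ⟨L, ?_, hL⟩
  exact eventually_mem_nhdsWithin.mono fun ε hε =>
    integrableOn_pressureKernel_compl_closedBall hv.continuous hv2 x hε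

/-- With both inputs discharged, the commutator representation of layer 3 and the `L²` bound of
layer 4 hold unconditionally; in particular the junk branch of `NS.normalisedPressure` is never
taken for `C¹` finite-energy fields (`hasPressurePV_of_contDiff.normalisedPressure_eq`).
[cite: Stein1971, Ch. III §1] -/
theorem normalisedPressure_eq_of_contDiff (hv : ContDiff ℝ 1 v) (hE : (∫⁻ x, ‖v x‖ₑ ^ 2) < ⊤)
    (x : ℝ³) : ∃ L, HasPressurePV v x L ∧ normalisedPressure v x = -‖v x‖ ^ 2 / 3 + L :=
  hasPressurePV_of_contDiff_holds.normalisedPressure_eq hv hE x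

end PV

end Literature.Analysis.FluidPDE
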